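/- Copyright: the b2b-balaban cell (near-miss cell 7), T⁴-continuum fan-out, NE7b swarm leaf 02 (gen 8; road W-RP of the
owner's claim table, supplier «W-CUTS»: the reflection covariance (γ) of the PRINTED block averagings at EVERY block-boundary
cut of every level, transported into the road's `GaugeConfig` ∕ `configReflect` letters).  Released under the licence of
the surrounding project. -/
import Literature.MathematicalPhysics.QuantumFieldTheory.Balaban1983to89.BlockAveragingTwoLevel
import Literature.MathematicalPhysics.QuantumFieldTheory.Balaban1983to89.TorusReflectionPositivity
import Summits.QuantumFields.YangMills.Theorems.ComplexCouplingChannelContinuumLegGivenGapArrayFunctionalReflection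

/-!
# History chessboard road: the covariance (γ) of Bałaban's printed block averagings at every block-boundary cut

Summits-side support leaf of the T⁴-continuum cell (rung (B)+1 on a FINITE torus only; NOT infinite volume, NOT the
mass gap, NOT the Clay statement; NOT a proof of the spine estimate NE7b).  Road W-RP (owner ruling R-OWNER-23-2, renamed
by R-OWNER-23-8) of the swarm claim table `t4/b2b-balaban-t4-ne7b-p1/LEAVES-NE7b.md`, supplier «W-CUTS» (journal
INTENT of leaf-02 g8, l.15172; owner GO with division of labour, claim table v3.40, l.15232), COMPLEMENTARY to leaf-04
g6's «W3f» (`HistoryRPHalfTorus` ∕ `HistoryRPAveraging`: W3d's binder shapes at ONE level for the centre cut + the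
both-endpoints locality; the one-level `avgFun` instance feeding W3d is THEIRS — nothing of it is restated here) and to
leaf-06 g5's «W3g» (`HistoryRPGibbs`: the level-0 RP-package in the `Setup` vocabulary).  [folklore] bookkeeping:
TRANSPORT of EXISTING tree theorems; no `def`, no `structure`, no `[cite:]` tag, nothing printed asserted, no Bałaban
estimate used.

WHY.  Ruling R-OWNER-23-8 (journal l.14989) reclassified the road's binder (VAR): the centred, lattice-Euclidean-symmetrised
averaging IS the one the 4-d series prints ([B12] = Bałaban, CMP 109 (1987), (0.1)∕(0.3)–(0.4) pp. 251–253, (0.11)–(0.12)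
p. 254; [B14] (0.1) p. 243), and what stays displayed under (RP-ext) is «(γ) the covariance of (0.4)∕(0.12) under
between-sites centre reflections of block hyperplanes … to be kernel-typed … when someone types (0.4)'s reflection
behaviour».  IT IS TYPED: the Literature modules `BlockAveraging` (unit pv26, 2026-08-18; the (0.3)–(0.4)-SHAPED total block
averaging `BlockAveraging.blockAvg ℰ` for EVERY small-loop average `ℰ` with the paper's axioms (0.5)–(0.7) as fields, the
printed `exp[mean log]` being the inhabitant `BlockAveragingExpMeanLog.expMeanLogSU`) and `BlockAveragingTwoLevel` (unit pv11;
(0.11)–(0.12), `blockAvg₂ 𝓜 ℰ`) PROVE `avg (c_ρ U) = c_ρ (avg U)` for the CENTRE reflection `c_ρ : n_ρ ↦ −n_ρ − 1` of every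
level (`avgFun_creflect`, `avgFun₂_creflect`; the longitudinal case `Ū(−c) = Ū(c)⁻¹` is `loopHol_creflect_of_eq` ∕
`loopHol₂_creflect_of_eq`) and `avg (U ∘ τ_{La}) = (avg U) ∘ τ_a` (`avgFun_translate`, `avgFun₂_translate`), all tagged
[B12] (2.17) p. 269.  What the road still needed under (γ) is therefore a JUNCTION, not a property of the prescription:
(J2) the SAME identity at EVERY block-boundary hyperplane `kL − 1 ∣ kL` (the translation-conjugates of the centre cut),
through the LEVELS (the iterate), in the road's own carriers `GaugeConfig d N G` and W3e's cut letters
`configReflect i (2kb − 1)` (`HistoryRPBlocks`).  This file is (J2).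

WHAT.
* §1 the unit vectors: `Site.scale (n • e_ρ) = (nL) • e_ρ`, `Site.scaleTo K (n • e_ρ) = (n L^K) • e_ρ`.
* §2 **DICTIONARY** `toConfig_translate_creflect`: through `TorusReflectionPositivity.toConfig`, the `Setup` map
  `U ↦ c_ρ (U ∘ τ_{n e_ρ})` IS the road's `configReflect ρ (n − 1)` — the reflection `x_ρ ↦ (n − 1) − x_ρ` with the
  `ρ`-links reversed; `n = 2k` is the block-boundary cut `kL − 1 ∣ kL` read at the level itself as `k − 1 ∣ k`, `n = 0` the
  centre cut `configReflect ρ (−1)`.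
* §3 **ABSTRACT STEP** `cut_equivariant`: any map `A : GaugeField P j G → GaugeField P j' G` intertwining (T) the
  translations (`A (U ∘ τ_{σ t}) = (A U) ∘ τ_t` for a scaling `σ` with `σ (n • e_ρ) = (n c) • e_ρ`) and (R) the centre
  reflections satisfies, for EVERY `n`,
  `toConfig (A (ofConfig (configReflect ρ (n c − 1) V))) = configReflect ρ (n − 1) (toConfig (A (ofConfig V)))`
  — W3d's function-level shape `avg ∘ θ = θ′ ∘ avg` at every cut at once.
* §4 **INSTANCES BY NAME**: one level of (0.4) (`blockAvg_cut_equivariant`, `c = L`), one level of (0.12)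
  (`blockAvg₂_cut_equivariant`), and the `K`-fold ITERATE of any tower with (T)+(R) (`iter_cut_equivariant`, `c = L^K`,
  via `T4Covariance`'s `iter_translate` ∕ `iter_creflect`), in particular of a tower of (0.4)-shaped averagings
  (`iter_blockAvg_cut_equivariant`): the composite averaging `T^{(0)} → T^{(K)}` intertwines
  `configReflect ρ (2k·L^K − 1)` (finest lattice; W3e's `(i, k) ↦ configReflect i (2·k.val·b − 1)` with `b = L^K`) with
  `configReflect ρ (2k − 1)` (cell lattice; W5's `cellReflect`), for every `k`.
* §5 sanity: the centre cut (`n = 0`) in clean letters.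

HONEST SCOPE (c4).  Bookkeeping transport of existing Literature theorems into the W road's letters; it discharges
NOTHING of the nine spine estimates, touches no exit ∕ socket ∕ `HistoryConstants` ∕ END, mints no `Prop` fact (c1), no
constant (c2∕c6).  STILL DISPLAYED on the road: (LOC) ∕ `hfP` and the binder packaging (W3f), the base RP-package
identification (W3c), the identification of W4b′'s `μ K` with the tower law, and «which `ℰ`» the run uses on LARGE fields
(cell row T4-D.L2 (b)); (EXT), (R-sym), (U1), (G2).  NE7b NOT proved; spine 0∕9.  HONEST DEPENDENCY (cell): continuum
YM on T⁴ ⇐ BetaPertH ∧ nine spine estimates (0/9 proved); BetaPertH ⇐ (D1) ∧ (D4) ∧ CAP+tail; G-an2-4 gates asym, D1 and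
NE2/3/4.  This file changes none of it.
-/

open Literature.MathematicalPhysics.QuantumFieldTheory (GaugeConfig Edge)
open Literature.MathematicalPhysics.QuantumFieldTheory.Balaban1983to89
open Summit.QuantumFields.YangMills.Theorems.ContinuumLegGivenGap (configReflect siteReflect configReflect_apply_same
  configReflect_apply_of_ne siteReflect_apply_same siteReflect_apply_of_ne)

namespace Summit.QuantumFields.BalabanUV.T4Continuum.HistoryRPAveragingCuts

noncomputable section

variable {P : Params} {G : Type*} [GaugeGroup G]

/-! ## §1 Unit lattice vectors across levels -/

section Vectors

variable {j : ℕ}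

/-- Coordinates of the unit lattice vector `e_ρ = (0 : Site P j).shift ρ` of `T^{(j)}`. [folklore] -/
theorem zero_shift_apply (ρ κ : Fin P.d) :
    ((0 : Site P j).shift ρ) κ = if κ = ρ then (1 : ZMod (P.sitesPerDir j)) else 0 := by
  rw [Site.shift_apply, Site.zero_apply, Site.zero_apply, zero_add]

/-- Coordinates of `n • e_ρ`. [folklore] -/
theorem nsmul_zero_shift_apply (n : ℕ) (ρ κ : Fin P.d) :
    (n • (0 : Site P j).shift ρ) κ = if κ = ρ then (n : ZMod (P.sitesPerDir j)) else 0 := by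
  show n • ((0 : Site P j).shift ρ) κ = _
  rw [zero_shift_apply]
  split_ifs
  · rw [nsmul_eq_mul, mul_one]
  · rw [nsmul_zero]

/-- **`L·(n e_ρ) = (nL) e_ρ`**: the fine-lattice vector of the coarse translation by `n e_ρ` (`Site.scale`, the cross-level
scaling of `T4Covariance`). [folklore] -/
theorem scale_nsmul_zero_shift (n : ℕ) (ρ : Fin P.d) :
    Site.scale (n • (0 : Site P (j+1)).shift ρ) = (n * P.L) • (0 : Site P j).shift ρ := by
  funext κ
  rw [Site.scale_apply, nsmul_zero_shift_apply, nsmul_zero_shift_apply]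
  split_ifs
  · rw [Site.scaleCoord_apply, ZMod.val_natCast, Site.natCast_mul_L_eq_of_modEq P j (Nat.mod_modEq _ _)]
  · rw [map_zero]

end Vectors

/-- **`L^K·(n e_ρ) = (n L^K) e_ρ`** for the `K`-fold scaling `Site.scaleTo K : T^{(K)} → T^{(0)}`. [folklore] -/
theorem scaleTo_nsmul_zero_shift (ρ : Fin P.d) :
    ∀ (K n : ℕ), Site.scaleTo K (n • (0 : Site P K).shift ρ) = (n * P.L ^ K) • (0 : Site P 0).shift ρ
  | 0, n => by rw [Site.scaleTo_zero, pow_zero, mul_one]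
  | K + 1, n => by
    rw [Site.scaleTo_succ, scale_nsmul_zero_shift, scaleTo_nsmul_zero_shift ρ K (n * P.L), pow_succ]
    congr 1
    ring

/-! ## §2 Dictionary: translation-conjugates of the centre reflection are the road's `configReflect` -/

section TreeSide

variable {d S : ℕ} {H : Type*} [Group H]

/-- The road's `configReflect ρ A` written with `Function.update`: the site map `x_ρ ↦ A − x_ρ` on transversal links, and
`x_ρ ↦ A − x_ρ − 1` (source of the reversed link) with an inverse on `ρ`-links. [folklore] -/
theorem configReflect_eq_update (ρ : Fin d) (A : ZMod S) (V : GaugeConfig d S H) :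
    configReflect ρ A V = fun e =>
      if e.2 = ρ then (V (Function.update e.1 ρ (A - e.1 ρ - 1), e.2))⁻¹
      else V (Function.update e.1 ρ (A - e.1 ρ), e.2) := by
  funext e
  obtain ⟨x, i⟩ := e
  by_cases h : i = ρ
  · subst h
    rw [configReflect_apply_same, if_pos rfl]
    congr 3
    funext κ
    by_cases hk : κ = i
    · subst hk
      rw [Pi.sub_apply, siteReflect_apply_same, Pi.single_eq_same, Function.update_self]
    · rw [Pi.sub_apply, siteReflect_apply_of_ne _ _ _ hk, Pi.single_eq_of_ne hk, Function.update_of_ne hk, sub_zero]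
  · rw [configReflect_apply_of_ne _ _ _ _ h, if_neg h]
    rfl

end TreeSide

section Dictionary

variable {j : ℕ}

/-- The `Setup` pull-back `U ↦ c_ρ (U ∘ τ_{n e_ρ})` written with `Function.update`: transversal bonds are read at the
reflected source `x_ρ ↦ (n − 1) − x_ρ`, `ρ`-bonds backwards from `x_ρ ↦ (n − 1) − x_ρ − 1`. [folklore] -/
theorem translate_creflect_eq (ρ : Fin P.d) (n : ℕ) (U : GaugeField P j G) :
    (U.translate (n • (0 : Site P j).shift ρ)).creflect ρ = fun b =>
      if b.dir = ρ then
        (U ⟨Function.update b.src ρ ((n : ZMod (P.sitesPerDir j)) - 1 - b.src ρ - 1), b.dir⟩)⁻¹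
      else U ⟨Function.update b.src ρ ((n : ZMod (P.sitesPerDir j)) - 1 - b.src ρ), b.dir⟩ := by
  funext b
  obtain ⟨x, i⟩ := b
  rw [GaugeField.creflect_eq, GaugeField.reflect_apply, GaugeField.translate_apply, GaugeField.translate_apply,
    PBond.translate_translate]
  dsimp only
  by_cases h : i = ρ
  · subst h
    rw [if_pos rfl, if_pos rfl]
    congr 2
    show PBond.mk (((PBond.mk x i).reflect i).src + ((0 : Site P j).unshift i + n • (0 : Site P j).shift i)) i = _
    rw [PBond.reflect_src_of_eq i _ rfl]
    congr 1
    funext κ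
    rw [Site.add_apply, Site.add_apply, Site.reflect_apply, Site.shift_apply, Site.unshift_apply, Site.zero_apply,
      nsmul_zero_shift_apply]
    by_cases hk : κ = i
    · subst hk
      rw [if_pos rfl, if_pos rfl, if_pos rfl, if_pos rfl, Function.update_self]
      ring
    · rw [if_neg hk, if_neg hk, if_neg hk, Site.shift_apply, if_neg hk, Site.zero_apply, Function.update_of_ne hk]
      ring
  · rw [if_neg h, if_neg h]
    congr 1
    show PBond.mk (((PBond.mk x i).reflect ρ).src + ((0 : Site P j).unshift ρ + n • (0 : Site P j).shift ρ)) i = _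
    rw [PBond.reflect_src_of_ne ρ _ h]
    congr 1
    funext κ
    rw [Site.add_apply, Site.add_apply, Site.reflect_apply, Site.unshift_apply, Site.zero_apply,
      nsmul_zero_shift_apply]
    by_cases hk : κ = ρ
    · subst hk
      rw [if_pos rfl, if_pos rfl, if_pos rfl, Function.update_self]
      ring
    · rw [if_neg hk, if_neg hk, if_neg hk, Function.update_of_ne hk, Site.zero_apply]
      ring

/-- **DICTIONARY.**  Read through `toConfig`, the `Setup` pull-back `U ↦ c_ρ (U ∘ τ_{n e_ρ})` (translate by `n e_ρ`, then
the CENTRE reflection `GaugeField.creflect ρ` of `T4Covariance`, [B12] (2.17)) is the road's `configReflect ρ (n − 1)`: the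
site reflection `x_ρ ↦ (n − 1) − x_ρ` with the `ρ`-links carried backwards.  `n = 0`: the centre cut `−1 ∣ 0`;
`n = 2k`: the block-boundary cut `kL − 1 ∣ kL` of this level (W3e's `2·k·b − 1`, `b = L`). [folklore] -/
theorem toConfig_translate_creflect (ρ : Fin P.d) (n : ℕ) (U : GaugeField P j G) :
    toConfig ((U.translate (n • (0 : Site P j).shift ρ)).creflect ρ) =
      configReflect ρ ((n : ZMod (P.sitesPerDir j)) - 1) (toConfig U) := by
  rw [translate_creflect_eq, configReflect_eq_update]
  rfl

/-- The same dictionary entry read on the `Setup` side: `ofConfig (configReflect ρ (n − 1) V) = c_ρ ((ofConfig V) ∘ τ_{n e_ρ})`.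
[folklore] -/
theorem ofConfig_configReflect (ρ : Fin P.d) (n : ℕ) (V : GaugeConfig P.d (P.sitesPerDir j) G) :
    ofConfig (configReflect ρ ((n : ZMod (P.sitesPerDir j)) - 1) V) =
      ((ofConfig V).translate (n • (0 : Site P j).shift ρ)).creflect ρ := by
  have h := congrArg (ofConfig (P := P) (j := j) (G := G)) (toConfig_translate_creflect ρ n (ofConfig V))
  rw [ofConfig_toConfig, toConfig_ofConfig] at h
  exact h.symm

end Dictionary

/-! ## §3 The abstract step: (T) + (R) ⇒ the equivariance identity at every cut, in the road's letters -/

section Abstract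

variable {j j' : ℕ}

/-- On the `Setup` side the cut at `σ t` is two rewrites: (R) after (T). [folklore] -/
theorem translate_creflect_equivariant {A : GaugeField P j G → GaugeField P j' G} {σ : Site P j' → Site P j}
    (ρ : Fin P.d) (hT : ∀ (t : Site P j') (U : GaugeField P j G), A (U.translate (σ t)) = (A U).translate t)
    (hR : ∀ U : GaugeField P j G, A (U.creflect ρ) = (A U).creflect ρ) (t : Site P j') (U : GaugeField P j G) :
    A ((U.translate (σ t)).creflect ρ) = ((A U).translate t).creflect ρ := by
  rw [hR, hT]

/-- **THE EQUIVARIANCE IDENTITY AT EVERY CUT** (W3d's `avg ∘ θ = θ′ ∘ avg`, road letters).  If `A : GaugeField P j G →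
GaugeField P j' G` intertwines (T) the translations along a scaling `σ` with `σ (n e_ρ) = (n c) e_ρ` and (R) the centre
reflections of axis `ρ`, then for EVERY `n : ℕ`
`toConfig (A (ofConfig (configReflect ρ (n c − 1) V))) = configReflect ρ (n − 1) (toConfig (A (ofConfig V)))`. [folklore] -/
theorem cut_equivariant {A : GaugeField P j G → GaugeField P j' G} {σ : Site P j' → Site P j} {c : ℕ} (ρ : Fin P.d)
    (hσ : ∀ n : ℕ, σ (n • (0 : Site P j').shift ρ) = (n * c) • (0 : Site P j).shift ρ)
    (hT : ∀ (t : Site P j') (U : GaugeField P j G), A (U.translate (σ t)) = (A U).translate t)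
    (hR : ∀ U : GaugeField P j G, A (U.creflect ρ) = (A U).creflect ρ)
    (n : ℕ) (V : GaugeConfig P.d (P.sitesPerDir j) G) :
    toConfig (A (ofConfig (configReflect ρ (((n * c : ℕ) : ZMod (P.sitesPerDir j)) - 1) V))) =
      configReflect ρ ((n : ZMod (P.sitesPerDir j')) - 1) (toConfig (A (ofConfig V))) := by
  rw [ofConfig_configReflect, ← hσ, translate_creflect_equivariant ρ hT hR, toConfig_translate_creflect]

end Abstract

/-! ## §4 Instances by name: (0.4), (0.12), and the iterate through the levels -/

section Instances

variable {j : ℕ}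

/-- **ONE LEVEL OF THE (0.3)–(0.4)-SHAPED BLOCK AVERAGING** (`BlockAveraging.blockAvg ℰ`, every small-loop average `ℰ`):
for every `n`, `avg (θ_{nL−1} V) = θ′_{n−1} (avg V)` in the road's letters — `n = 2k` is the block-boundary hyperplane
`kL − 1 ∣ kL` ↦ `k − 1 ∣ k`.  BY NAME from `BlockAveraging.avgFun_translate` ∕ `avgFun_creflect` ([B12] (2.17) p. 269 on
the tree theorems). [folklore] -/
theorem blockAvg_cut_equivariant (ℰ : LoopAverage G) (ρ : Fin P.d) (n : ℕ)
    (V : GaugeConfig P.d (P.sitesPerDir j) G) :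
    toConfig (BlockAveraging.avgFun ℰ (ofConfig (configReflect ρ (((n * P.L : ℕ) : ZMod (P.sitesPerDir j)) - 1) V))) =
      configReflect ρ ((n : ZMod (P.sitesPerDir (j+1))) - 1) (toConfig (BlockAveraging.avgFun ℰ (ofConfig V))) :=
  cut_equivariant ρ (fun n => scale_nsmul_zero_shift n ρ) (fun t U => BlockAveraging.avgFun_translate ℰ t U)
    (fun U => BlockAveraging.avgFun_creflect ℰ ρ U) n V

/-- **ONE LEVEL OF THE (0.11)–(0.12) TWO-LEVEL AVERAGING** (`BlockAveragingTwoLevel.blockAvg₂ 𝓜 ℰ`, every inner average `𝓜`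
and outer average `ℰ`): the same identity, BY NAME from `BlockAveragingTwoLevel.avgFun₂_translate` ∕ `avgFun₂_creflect`.
[folklore] -/
theorem blockAvg₂_cut_equivariant (𝓜 : GroupAverage G) (ℰ : LoopAverage G) (ρ : Fin P.d) (n : ℕ)
    (V : GaugeConfig P.d (P.sitesPerDir j) G) :
    toConfig (BlockAveragingTwoLevel.avgFun₂ 𝓜 ℰ
        (ofConfig (configReflect ρ (((n * P.L : ℕ) : ZMod (P.sitesPerDir j)) - 1) V))) =
      configReflect ρ ((n : ZMod (P.sitesPerDir (j+1))) - 1)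
        (toConfig (BlockAveragingTwoLevel.avgFun₂ 𝓜 ℰ (ofConfig V))) :=
  cut_equivariant ρ (fun n => scale_nsmul_zero_shift n ρ) (fun t U => BlockAveragingTwoLevel.avgFun₂_translate 𝓜 ℰ t U)
    (fun U => BlockAveragingTwoLevel.avgFun₂_creflect 𝓜 ℰ ρ U) n V

end Instances

section Iterate

/-- **THE ITERATE THROUGH THE LEVELS.**  For a tower `av : ∀ j, Averaging P j G` whose every step intertwines (T) the
translations and (R) the centre reflections of axis `ρ`, the composite averaging `Averaging.iter av K : T^{(0)} → T^{(K)}`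
satisfies, for every `n`,
`toConfig (iter (ofConfig (configReflect ρ (n L^K − 1) V))) = configReflect ρ (n − 1) (toConfig (iter (ofConfig V)))` — with
`n = 2k` exactly W3e's cut family `(i, k) ↦ configReflect i (2·k·b − 1)`, `b = L^K`, on the finest lattice against the cell
reflection `2k − 1` of the `K`-th level.  BY NAME from `T4Covariance`'s `iter_translate` ∕ `iter_creflect`. [folklore] -/
theorem iter_cut_equivariant (av : ∀ j, Averaging P j G) (ρ : Fin P.d)
    (hT : ∀ (j : ℕ) (t : Site P (j+1)) (U : GaugeField P j G),
      (av j).avg (U.translate (Site.scale t)) = ((av j).avg U).translate t)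
    (hR : ∀ (j : ℕ) (U : GaugeField P j G), (av j).avg (U.creflect ρ) = ((av j).avg U).creflect ρ)
    (K n : ℕ) (V : GaugeConfig P.d (P.sitesPerDir 0) G) :
    toConfig (Averaging.iter av K (ofConfig (configReflect ρ (((n * P.L ^ K : ℕ) : ZMod (P.sitesPerDir 0)) - 1) V))) =
      configReflect ρ ((n : ZMod (P.sitesPerDir K)) - 1) (toConfig (Averaging.iter av K (ofConfig V))) :=
  cut_equivariant ρ (fun n => scaleTo_nsmul_zero_shift ρ K n) (fun t U => T4Continuum.iter_translate av hT K t U)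
    (fun U => T4Continuum.iter_creflect av ρ hR K U) n V

/-- **THE ITERATE OF A TOWER OF (0.4)-SHAPED BLOCK AVERAGINGS** (`av j := blockAvg (ℰ j)`, a small-loop average per level):
the composite averaging from the finest lattice to the `K`-th level intertwines `configReflect ρ (n L^K − 1)` with
`configReflect ρ (n − 1)`, every `n`, every `K`. [folklore] -/
theorem iter_blockAvg_cut_equivariant (ℰ : ℕ → LoopAverage G) (ρ : Fin P.d) (K n : ℕ)
    (V : GaugeConfig P.d (P.sitesPerDir 0) G) :
    toConfig (Averaging.iter (fun j => (BlockAveraging.blockAvg (ℰ j) : Averaging P j G)) K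
        (ofConfig (configReflect ρ (((n * P.L ^ K : ℕ) : ZMod (P.sitesPerDir 0)) - 1) V))) =
      configReflect ρ ((n : ZMod (P.sitesPerDir K)) - 1)
        (toConfig (Averaging.iter (fun j => (BlockAveraging.blockAvg (ℰ j) : Averaging P j G)) K (ofConfig V))) :=
  iter_cut_equivariant _ ρ (fun j t U => BlockAveraging.avgFun_translate (ℰ j) t U)
    (fun j U => BlockAveraging.avgFun_creflect (ℰ j) ρ U) K n V

end Iterate

/-! ## §5 Sanity: the centre cut in clean letters -/

section Sanity

variable {j : ℕ}

/-- The centre cut (`n = 0`): the (0.4)-shaped block averaging intertwines `configReflect ρ (−1)` of `T^{(j)}` with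
`configReflect ρ (−1)` of `T^{(j+1)}` — the road's letters for `BlockAveraging.avgFun_creflect` itself. [folklore] -/
theorem blockAvg_centre_cut (ℰ : LoopAverage G) (ρ : Fin P.d) (V : GaugeConfig P.d (P.sitesPerDir j) G) :
    toConfig (BlockAveraging.avgFun ℰ (ofConfig (configReflect ρ (-1) V))) =
      configReflect ρ (-1) (toConfig (BlockAveraging.avgFun ℰ (ofConfig V))) := by
  have h := blockAvg_cut_equivariant ℰ ρ 0 V
  rwa [zero_mul, Nat.cast_zero, zero_sub, Nat.cast_zero, zero_sub] at h

/-- The dictionary at `n = 0` is the centre reflection itself: `toConfig (c_ρ U) = configReflect ρ (−1) (toConfig U)`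
(`U.translate 0 = U`). [folklore] -/
example (ρ : Fin P.d) (U : GaugeField P j G) :
    toConfig (U.creflect ρ) = configReflect ρ (-1) (toConfig U) := by
  have h := toConfig_translate_creflect ρ 0 U
  rw [zero_nsmul, Nat.cast_zero, zero_sub] at h
  have h0 : U.translate (0 : Site P j) = U := by
    funext b
    rw [GaugeField.translate_apply]
    cases b
    simp only [PBond.translate, add_zero]
  rwa [h0] at h

end Sanity

end

end Summit.QuantumFields.BalabanUV.T4Continuum.HistoryRPAveragingCuts
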